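import Mathlib
import Summits.Ventures.PercRepro2.TwoTypedEdges
import Summits.Ventures.PercRepro2.ThreeTypedAbstract

/-!
# Three typed edges, modulo the finite statement (blind cell PercRepro2, night-3, 2026-08-24)

Row 2′TRI for THREE typed edges with the finite core factored out: `typedCount_triple_K3_nonneg`
proves `0 ≤ typedCount {e₁, e₂, e₃} z τ K₃` for every graph, marking, pinning and all eight type
triples FROM the Boolean `allOk3 = true` of `ThreeTypedAbstract.lean` (every canonical labelling of
the eleven points `a₁, a₂, o, b, a₃, u₁, w₁, u₂, w₂, u₃, w₃` passes the eight cube tests); hence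
`TypedBases` for `|F| ≤ 3` and (HCOV) for every weight vector with at most three fractional edges,
both modulo `allOk3 = true`.  Everything except that finite Boolean is kernel-checked here: the
expansion `typedCount_triple` (the sum over the eight configurations of the merge cube), the
labelling bridge (`lab`, `conn_update_lab`, `st_eq_stL` of `TwoTypedBridge.lean`, seven merges),
the coverage `ok3_of_canon`, and the table evaluation `lk1_eq` / `lk2_eq`.
-/

namespace Summit.Ventures.PercRepro2

open UnionCluster

namespace CovForm

namespace TwoTyped

open OneTyped

/-! ## The theorem, conditionally on the finite statement `allOk3 = true` -/

section Main3

open Classical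

variable {V : Type*} {E : Type*} [Fintype E] [DecidableEq E] {R : Type*} [Field R]
  [LinearOrder R] [IsStrictOrderedRing R]
variable (ends : E → Sym2 V) (o a₁ a₂ a₃ b : V)

omit [LinearOrder R] [IsStrictOrderedRing R] in
/-- If the roots are joined once the three typed edges are closed, they are joined in every
configuration of the fibre and the typed count vanishes. -/
lemma typedCount_triple_eq_zero (e₁ e₂ e₃ : E) (h12 : e₁ ≠ e₂) (h13 : e₁ ≠ e₃) (h23 : e₂ ≠ e₃)
    (z : Config E) (τ : E → ℕ)
    (hQ : Conn ends (Function.update (Function.update (Function.update z e₁ false) e₂ false) e₃ false)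
      a₂ a₁) :
    typedCount {e₁, e₂, e₃} z τ (K3 ends o a₁ a₂ a₃ b : Config E → Config E → Config E → R) = 0 := by
  unfold typedCount
  refine Finset.sum_eq_zero fun x _ => Finset.sum_eq_zero fun y _ => Finset.sum_eq_zero fun w _ => ?_
  split_ifs with h
  · apply K3_zero_x
    refine conn_mono ?_ hQ
    intro e
    by_cases he : e ∈ ({e₁, e₂, e₃} : Finset E)
    · have h0 : Function.update (Function.update (Function.update z e₁ false) e₂ false) e₃ false e =
          false := by
        simp only [Finset.mem_insert, Finset.mem_singleton] at he
        rcases he with rfl | rfl | rfl <;>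
          simp [Function.update_of_ne h12, Function.update_of_ne h13, Function.update_of_ne h23]
      rw [h0]
      exact Bool.false_le _
    · rw [(h.1 e he).1]
      simp only [Finset.mem_insert, Finset.mem_singleton, not_or] at he
      exact le_of_eq (by rw [Function.update_of_ne he.2.2, Function.update_of_ne he.2.1,
        Function.update_of_ne he.1])
  · rfl

set_option maxHeartbeats 4000000 in
/-- **Three typed edges, modulo the finite statement**: if every canonical labelling of the eleven
points passes the eight cube tests (`allOk3 = true`), the typed count of `K₃` with three typed
edges is nonnegative for every pinned configuration and all eight type triples. -/
theorem typedCount_triple_K3_nonneg (hall : allOk3 = true) (e₁ e₂ e₃ : E) (h12 : e₁ ≠ e₂)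
    (h13 : e₁ ≠ e₃) (h23 : e₂ ≠ e₃) (z : Config E) (τ : E → ℕ)
    (h₁ : τ e₁ = 1 ∨ τ e₁ = 2) (h₂ : τ e₂ = 1 ∨ τ e₂ = 2) (h₃ : τ e₃ = 1 ∨ τ e₃ = 2) :
    0 ≤ typedCount {e₁, e₂, e₃} z τ (K3 ends o a₁ a₂ a₃ b : Config E → Config E → Config E → R) := by
  obtain ⟨⟨u₁, w₁⟩, hu₁⟩ := Quot.exists_rep (ends e₁)
  obtain ⟨⟨u₂, w₂⟩, hu₂⟩ := Quot.exists_rep (ends e₂)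
  obtain ⟨⟨u₃, w₃⟩, hu₃⟩ := Quot.exists_rep (ends e₃)
  have hends₁ : ends e₁ = s(u₁, w₁) := hu₁.symm
  have hends₂ : ends e₂ = s(u₂, w₂) := hu₂.symm
  have hends₃ : ends e₃ = s(u₃, w₃) := hu₃.symm
  by_cases hQ : Conn ends (Function.update (Function.update (Function.update z e₁ false) e₂ false)
      e₃ false) a₂ a₁
  · rw [typedCount_triple_eq_zero ends o a₁ a₂ a₃ b e₁ e₂ e₃ h12 h13 h23 z τ hQ]
  rw [typedCount_triple z e₁ e₂ e₃ h12 h13 h23]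
  simp only [Fintype.sum_bool, Bool.toNat_true, Bool.toNat_false]
  set z000 := Function.update (Function.update (Function.update z e₁ false) e₂ false) e₃ false with hz000
  set z100 := Function.update (Function.update (Function.update z e₁ true) e₂ false) e₃ false with hz100
  set z010 := Function.update (Function.update (Function.update z e₁ false) e₂ true) e₃ false with hz010
  set z001 := Function.update (Function.update (Function.update z e₁ false) e₂ false) e₃ true with hz001
  set z110 := Function.update (Function.update (Function.update z e₁ true) e₂ true) e₃ false with hz110
  set z101 := Function.update (Function.update (Function.update z e₁ true) e₂ false) e₃ true with hz101
  set z011 := Function.update (Function.update (Function.update z e₁ false) e₂ true) e₃ true with hz011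
  set z111 := Function.update (Function.update (Function.update z e₁ true) e₂ true) e₃ true with hz111
  have e100 : z100 = Function.update z000 e₁ true := by
    rw [hz100, hz000, Function.update_comm h13.symm, Function.update_comm h12.symm, Function.update_idem]
  have e010 : z010 = Function.update z000 e₂ true := by
    rw [hz010, hz000, Function.update_comm h23.symm, Function.update_idem]
  have e001 : z001 = Function.update z000 e₃ true := by
    rw [hz001, hz000, Function.update_idem]
  have e110 : z110 = Function.update z100 e₂ true := by
    rw [hz110, hz100, Function.update_comm h23.symm, Function.update_idem]
  have e101 : z101 = Function.update z100 e₃ true := by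
    rw [hz101, hz100, Function.update_idem]
  have e011 : z011 = Function.update z010 e₃ true := by
    rw [hz011, hz010, Function.update_idem]
  have e111 : z111 = Function.update z110 e₃ true := by
    rw [hz111, hz110, Function.update_idem]
  -- the least-representative labelling of the eleven points in `z000` and its seven merges
  set f := lab ends o a₁ a₂ a₃ b [u₁, w₁, u₂, w₂, u₃, w₃] z000
  have hf : ∀ p q, f p = f q ↔ Conn ends z000 (pt o a₁ a₂ a₃ b [u₁, w₁, u₂, w₂, u₃, w₃] p) (pt o a₁ a₂ a₃ b [u₁, w₁, u₂, w₂, u₃, w₃] q) :=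
    fun p q => lab_eq_iff ends o a₁ a₂ a₃ b [u₁, w₁, u₂, w₂, u₃, w₃] z000 p q
  have hf0 : f 0 = 0 := lab_zero ends o a₁ a₂ a₃ b [u₁, w₁, u₂, w₂, u₃, w₃] z000
  have hle : ∀ i, f i ≤ i := lab_le ends o a₁ a₂ a₃ b [u₁, w₁, u₂, w₂, u₃, w₃] z000
  have hid : ∀ i, f (f i) = f i := lab_idem ends o a₁ a₂ a₃ b [u₁, w₁, u₂, w₂, u₃, w₃] z000
  have hg1 : ∀ p q, (mrg (f 5) (f 6) (f p)) = (mrg (f 5) (f 6) (f q)) ↔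
      Conn ends z100 (pt o a₁ a₂ a₃ b [u₁, w₁, u₂, w₂, u₃, w₃] p) (pt o a₁ a₂ a₃ b [u₁, w₁, u₂, w₂, u₃, w₃] q) := by
    intro p q
    rw [e100]
    exact conn_update_lab ends o a₁ a₂ a₃ b [u₁, w₁, u₂, w₂, u₃, w₃] z000 f hf (i := 5) (j := 6) hends₁ p q
  have hg2 : ∀ p q, (mrg (f 7) (f 8) (f p)) = (mrg (f 7) (f 8) (f q)) ↔
      Conn ends z010 (pt o a₁ a₂ a₃ b [u₁, w₁, u₂, w₂, u₃, w₃] p) (pt o a₁ a₂ a₃ b [u₁, w₁, u₂, w₂, u₃, w₃] q) := by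
    intro p q
    rw [e010]
    exact conn_update_lab ends o a₁ a₂ a₃ b [u₁, w₁, u₂, w₂, u₃, w₃] z000 f hf (i := 7) (j := 8) hends₂ p q
  have hg3 : ∀ p q, (mrg (f 9) (f 10) (f p)) = (mrg (f 9) (f 10) (f q)) ↔
      Conn ends z001 (pt o a₁ a₂ a₃ b [u₁, w₁, u₂, w₂, u₃, w₃] p) (pt o a₁ a₂ a₃ b [u₁, w₁, u₂, w₂, u₃, w₃] q) := by
    intro p q
    rw [e001]
    exact conn_update_lab ends o a₁ a₂ a₃ b [u₁, w₁, u₂, w₂, u₃, w₃] z000 f hf (i := 9) (j := 10) hends₃ p q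
  have hg12 : ∀ p q, (mrg (mrg (f 5) (f 6) (f 7)) (mrg (f 5) (f 6) (f 8)) (mrg (f 5) (f 6) (f p))) = (mrg (mrg (f 5) (f 6) (f 7)) (mrg (f 5) (f 6) (f 8)) (mrg (f 5) (f 6) (f q))) ↔
      Conn ends z110 (pt o a₁ a₂ a₃ b [u₁, w₁, u₂, w₂, u₃, w₃] p) (pt o a₁ a₂ a₃ b [u₁, w₁, u₂, w₂, u₃, w₃] q) := by
    intro p q
    rw [e110]
    exact conn_update_lab ends o a₁ a₂ a₃ b [u₁, w₁, u₂, w₂, u₃, w₃] z100 (fun p => (mrg (f 5) (f 6) (f p))) hg1 (i := 7) (j := 8) hends₂ p q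
  have hg13 : ∀ p q, (mrg (mrg (f 5) (f 6) (f 9)) (mrg (f 5) (f 6) (f 10)) (mrg (f 5) (f 6) (f p))) = (mrg (mrg (f 5) (f 6) (f 9)) (mrg (f 5) (f 6) (f 10)) (mrg (f 5) (f 6) (f q))) ↔
      Conn ends z101 (pt o a₁ a₂ a₃ b [u₁, w₁, u₂, w₂, u₃, w₃] p) (pt o a₁ a₂ a₃ b [u₁, w₁, u₂, w₂, u₃, w₃] q) := by
    intro p q
    rw [e101]
    exact conn_update_lab ends o a₁ a₂ a₃ b [u₁, w₁, u₂, w₂, u₃, w₃] z100 (fun p => (mrg (f 5) (f 6) (f p))) hg1 (i := 9) (j := 10) hends₃ p q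
  have hg23 : ∀ p q, (mrg (mrg (f 7) (f 8) (f 9)) (mrg (f 7) (f 8) (f 10)) (mrg (f 7) (f 8) (f p))) = (mrg (mrg (f 7) (f 8) (f 9)) (mrg (f 7) (f 8) (f 10)) (mrg (f 7) (f 8) (f q))) ↔
      Conn ends z011 (pt o a₁ a₂ a₃ b [u₁, w₁, u₂, w₂, u₃, w₃] p) (pt o a₁ a₂ a₃ b [u₁, w₁, u₂, w₂, u₃, w₃] q) := by
    intro p q
    rw [e011]
    exact conn_update_lab ends o a₁ a₂ a₃ b [u₁, w₁, u₂, w₂, u₃, w₃] z010 (fun p => (mrg (f 7) (f 8) (f p))) hg2 (i := 9) (j := 10) hends₃ p q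
  have hg123 : ∀ p q, (mrg (mrg (mrg (f 5) (f 6) (f 7)) (mrg (f 5) (f 6) (f 8)) (mrg (f 5) (f 6) (f 9))) (mrg (mrg (f 5) (f 6) (f 7)) (mrg (f 5) (f 6) (f 8)) (mrg (f 5) (f 6) (f 10))) (mrg (mrg (f 5) (f 6) (f 7)) (mrg (f 5) (f 6) (f 8)) (mrg (f 5) (f 6) (f p)))) = (mrg (mrg (mrg (f 5) (f 6) (f 7)) (mrg (f 5) (f 6) (f 8)) (mrg (f 5) (f 6) (f 9))) (mrg (mrg (f 5) (f 6) (f 7)) (mrg (f 5) (f 6) (f 8)) (mrg (f 5) (f 6) (f 10))) (mrg (mrg (f 5) (f 6) (f 7)) (mrg (f 5) (f 6) (f 8)) (mrg (f 5) (f 6) (f q)))) ↔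
      Conn ends z111 (pt o a₁ a₂ a₃ b [u₁, w₁, u₂, w₂, u₃, w₃] p) (pt o a₁ a₂ a₃ b [u₁, w₁, u₂, w₂, u₃, w₃] q) := by
    intro p q
    rw [e111]
    exact conn_update_lab ends o a₁ a₂ a₃ b [u₁, w₁, u₂, w₂, u₃, w₃] z110 (fun p => (mrg (mrg (f 5) (f 6) (f 7)) (mrg (f 5) (f 6) (f 8)) (mrg (f 5) (f 6) (f p)))) hg12 (i := 9) (j := 10) hends₃ p q
  -- the eight states through the labels
  have hS0 := st_eq_stL ends o a₁ a₂ a₃ b [u₁, w₁, u₂, w₂, u₃, w₃] z000 f hf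
  have hS1 := st_eq_stL ends o a₁ a₂ a₃ b [u₁, w₁, u₂, w₂, u₃, w₃] z100 (fun p => (mrg (f 5) (f 6) (f p))) hg1
  have hS2 := st_eq_stL ends o a₁ a₂ a₃ b [u₁, w₁, u₂, w₂, u₃, w₃] z010 (fun p => (mrg (f 7) (f 8) (f p))) hg2
  have hS3 := st_eq_stL ends o a₁ a₂ a₃ b [u₁, w₁, u₂, w₂, u₃, w₃] z001 (fun p => (mrg (f 9) (f 10) (f p))) hg3
  have hS12 := st_eq_stL ends o a₁ a₂ a₃ b [u₁, w₁, u₂, w₂, u₃, w₃] z110 (fun p => (mrg (mrg (f 5) (f 6) (f 7)) (mrg (f 5) (f 6) (f 8)) (mrg (f 5) (f 6) (f p)))) hg12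
  have hS13 := st_eq_stL ends o a₁ a₂ a₃ b [u₁, w₁, u₂, w₂, u₃, w₃] z101 (fun p => (mrg (mrg (f 5) (f 6) (f 9)) (mrg (f 5) (f 6) (f 10)) (mrg (f 5) (f 6) (f p)))) hg13
  have hS23 := st_eq_stL ends o a₁ a₂ a₃ b [u₁, w₁, u₂, w₂, u₃, w₃] z011 (fun p => (mrg (mrg (f 7) (f 8) (f 9)) (mrg (f 7) (f 8) (f 10)) (mrg (f 7) (f 8) (f p)))) hg23
  have hS123 := st_eq_stL ends o a₁ a₂ a₃ b [u₁, w₁, u₂, w₂, u₃, w₃] z111 (fun p => (mrg (mrg (mrg (f 5) (f 6) (f 7)) (mrg (f 5) (f 6) (f 8)) (mrg (f 5) (f 6) (f 9))) (mrg (mrg (f 5) (f 6) (f 7)) (mrg (f 5) (f 6) (f 8)) (mrg (f 5) (f 6) (f 10))) (mrg (mrg (f 5) (f 6) (f 7)) (mrg (f 5) (f 6) (f 8)) (mrg (f 5) (f 6) (f p))))) hg123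
  simp only [hf0] at hS0 hS1 hS2 hS3 hS12 hS13 hS23 hS123
  -- the labelling is canonical, so it is one of the enumerated ones
  have c1 : f 1 = 1 ∨ f 1 = 0 := by
    rcases canon_cases f 1 (hle 1) (hid 1) with h | ⟨k, hk, hk1, -⟩
    · simp [h]
    · interval_cases k
      simp [hk1]
  have c2 : f 2 = 2 ∨ f 2 = 0 ∨ (f 2 = 1 ∧ f 1 = 1) := by
    rcases canon_cases f 2 (hle 2) (hid 2) with h | ⟨k, hk, hk1, hk2⟩
    · simp [h]
    · interval_cases k <;> simp [hk1, hk2]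
  have c3 : f 3 = 3 ∨ f 3 = 0 ∨ (f 3 = 1 ∧ f 1 = 1) ∨ (f 3 = 2 ∧ f 2 = 2) := by
    rcases canon_cases f 3 (hle 3) (hid 3) with h | ⟨k, hk, hk1, hk2⟩
    · simp [h]
    · interval_cases k <;> simp [hk1, hk2]
  have c4 : f 4 = 4 ∨ f 4 = 0 ∨ (f 4 = 1 ∧ f 1 = 1) ∨ (f 4 = 2 ∧ f 2 = 2) ∨ (f 4 = 3 ∧ f 3 = 3) := by
    rcases canon_cases f 4 (hle 4) (hid 4) with h | ⟨k, hk, hk1, hk2⟩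
    · simp [h]
    · interval_cases k <;> simp [hk1, hk2]
  have c5 : f 5 = 5 ∨ f 5 = 0 ∨ (f 5 = 1 ∧ f 1 = 1) ∨ (f 5 = 2 ∧ f 2 = 2) ∨ (f 5 = 3 ∧ f 3 = 3) ∨ (f 5 = 4 ∧ f 4 = 4) := by
    rcases canon_cases f 5 (hle 5) (hid 5) with h | ⟨k, hk, hk1, hk2⟩
    · simp [h]
    · interval_cases k <;> simp [hk1, hk2]
  have c6 : f 6 = 6 ∨ f 6 = 0 ∨ (f 6 = 1 ∧ f 1 = 1) ∨ (f 6 = 2 ∧ f 2 = 2) ∨ (f 6 = 3 ∧ f 3 = 3) ∨ (f 6 = 4 ∧ f 4 = 4) ∨ (f 6 = 5 ∧ f 5 = 5) := by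
    rcases canon_cases f 6 (hle 6) (hid 6) with h | ⟨k, hk, hk1, hk2⟩
    · simp [h]
    · interval_cases k <;> simp [hk1, hk2]
  have c7 : f 7 = 7 ∨ f 7 = 0 ∨ (f 7 = 1 ∧ f 1 = 1) ∨ (f 7 = 2 ∧ f 2 = 2) ∨ (f 7 = 3 ∧ f 3 = 3) ∨ (f 7 = 4 ∧ f 4 = 4) ∨ (f 7 = 5 ∧ f 5 = 5) ∨ (f 7 = 6 ∧ f 6 = 6) := by
    rcases canon_cases f 7 (hle 7) (hid 7) with h | ⟨k, hk, hk1, hk2⟩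
    · simp [h]
    · interval_cases k <;> simp [hk1, hk2]
  have c8 : f 8 = 8 ∨ f 8 = 0 ∨ (f 8 = 1 ∧ f 1 = 1) ∨ (f 8 = 2 ∧ f 2 = 2) ∨ (f 8 = 3 ∧ f 3 = 3) ∨ (f 8 = 4 ∧ f 4 = 4) ∨ (f 8 = 5 ∧ f 5 = 5) ∨ (f 8 = 6 ∧ f 6 = 6) ∨ (f 8 = 7 ∧ f 7 = 7) := by
    rcases canon_cases f 8 (hle 8) (hid 8) with h | ⟨k, hk, hk1, hk2⟩
    · simp [h]
    · interval_cases k <;> simp [hk1, hk2]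
  have c9 : f 9 = 9 ∨ f 9 = 0 ∨ (f 9 = 1 ∧ f 1 = 1) ∨ (f 9 = 2 ∧ f 2 = 2) ∨ (f 9 = 3 ∧ f 3 = 3) ∨ (f 9 = 4 ∧ f 4 = 4) ∨ (f 9 = 5 ∧ f 5 = 5) ∨ (f 9 = 6 ∧ f 6 = 6) ∨ (f 9 = 7 ∧ f 7 = 7) ∨ (f 9 = 8 ∧ f 8 = 8) := by
    rcases canon_cases f 9 (hle 9) (hid 9) with h | ⟨k, hk, hk1, hk2⟩
    · simp [h]
    · interval_cases k <;> simp [hk1, hk2]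
  have c10 : f 10 = 10 ∨ f 10 = 0 ∨ (f 10 = 1 ∧ f 1 = 1) ∨ (f 10 = 2 ∧ f 2 = 2) ∨ (f 10 = 3 ∧ f 3 = 3) ∨ (f 10 = 4 ∧ f 4 = 4) ∨ (f 10 = 5 ∧ f 5 = 5) ∨ (f 10 = 6 ∧ f 6 = 6) ∨ (f 10 = 7 ∧ f 7 = 7) ∨ (f 10 = 8 ∧ f 8 = 8) ∨ (f 10 = 9 ∧ f 9 = 9) := by
    rcases canon_cases f 10 (hle 10) (hid 10) with h | ⟨k, hk, hk1, hk2⟩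
    · simp [h]
    · interval_cases k <;> simp [hk1, hk2]
  have hok := ok3_of_canon hall (f 1) (f 2) (f 3) (f 4) (f 5) (f 6) (f 7) (f 8) (f 9) (f 10)
    (hle 1) (hle 2) (hle 3) (hle 4) (hle 5) (hle 6) (hle 7) (hle 8) (hle 9) (hle 10)
    c1 c2 c3 c4 c5 c6 c7 c8 c9 c10
  have hq : ¬ f 1 = 0 := fun hq => hQ ((hf 1 0).mp (by rw [hq, hf0]))
  simp only [ok3, if_neg hq] at hok
  rw [← hS0, ← hS1, ← hS2, ← hS3, ← hS12, ← hS13, ← hS23, ← hS123] at hok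
  have v0 := valid_st ends o a₁ a₂ a₃ b z000
  have v1 := valid_st ends o a₁ a₂ a₃ b z100
  have v2 := valid_st ends o a₁ a₂ a₃ b z010
  have v3 := valid_st ends o a₁ a₂ a₃ b z001
  have v12 := valid_st ends o a₁ a₂ a₃ b z110
  have v13 := valid_st ends o a₁ a₂ a₃ b z101
  have v23 := valid_st ends o a₁ a₂ a₃ b z011
  have v123 := valid_st ends o a₁ a₂ a₃ b z111
  simp only [Bool.and_eq_true, Nat.ble_eq] at hok
  obtain ⟨⟨⟨⟨⟨⟨⟨k0, k1⟩, k2⟩, k3⟩, k4⟩, k5⟩, k6⟩, k7⟩ := hok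
  have l0_0 := lk1_eq _ _ v123 v0
  have l0_1 := lk2_eq' _ _ _ v0 v12 v3
  have l0_2 := lk2_eq' _ _ _ v0 v13 v2
  have l0_3 := lk2_eq' _ _ _ v0 v1 v23
  have l0_4 := lk2_eq' _ _ _ v1 v2 v3
  have i0 : (0 : ℤ) ≤ T1 (st ends o a₁ a₂ a₃ b z111) (st ends o a₁ a₂ a₃ b z000) + T2 (st ends o a₁ a₂ a₃ b z000) (st ends o a₁ a₂ a₃ b z110) (st ends o a₁ a₂ a₃ b z001) + T2 (st ends o a₁ a₂ a₃ b z000) (st ends o a₁ a₂ a₃ b z101) (st ends o a₁ a₂ a₃ b z010) + T2 (st ends o a₁ a₂ a₃ b z000) (st ends o a₁ a₂ a₃ b z100) (st ends o a₁ a₂ a₃ b z011) + T2 (st ends o a₁ a₂ a₃ b z100) (st ends o a₁ a₂ a₃ b z010) (st ends o a₁ a₂ a₃ b z001) := by omega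
  have c0 : (0 : R) ≤ ((T1 (st ends o a₁ a₂ a₃ b z111) (st ends o a₁ a₂ a₃ b z000) + T2 (st ends o a₁ a₂ a₃ b z000) (st ends o a₁ a₂ a₃ b z110) (st ends o a₁ a₂ a₃ b z001) + T2 (st ends o a₁ a₂ a₃ b z000) (st ends o a₁ a₂ a₃ b z101) (st ends o a₁ a₂ a₃ b z010) + T2 (st ends o a₁ a₂ a₃ b z000) (st ends o a₁ a₂ a₃ b z100) (st ends o a₁ a₂ a₃ b z011) + T2 (st ends o a₁ a₂ a₃ b z100) (st ends o a₁ a₂ a₃ b z010) (st ends o a₁ a₂ a₃ b z001) : ℤ) : R) := by exact_mod_cast i0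
  have l1_0 := lk1_eq _ _ v12 v3
  have l1_1 := lk2_eq' _ _ _ v0 v123 v3
  have l1_2 := lk2_eq' _ _ _ v1 v23 v3
  have l1_3 := lk2_eq' _ _ _ v13 v2 v3
  have l1_4 := lk2_eq' _ _ _ v0 v13 v23
  have i1 : (0 : ℤ) ≤ T1 (st ends o a₁ a₂ a₃ b z110) (st ends o a₁ a₂ a₃ b z001) + T2 (st ends o a₁ a₂ a₃ b z000) (st ends o a₁ a₂ a₃ b z111) (st ends o a₁ a₂ a₃ b z001) + T2 (st ends o a₁ a₂ a₃ b z100) (st ends o a₁ a₂ a₃ b z011) (st ends o a₁ a₂ a₃ b z001) + T2 (st ends o a₁ a₂ a₃ b z101) (st ends o a₁ a₂ a₃ b z010) (st ends o a₁ a₂ a₃ b z001) + T2 (st ends o a₁ a₂ a₃ b z000) (st ends o a₁ a₂ a₃ b z101) (st ends o a₁ a₂ a₃ b z011) := by omega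
  have c1 : (0 : R) ≤ ((T1 (st ends o a₁ a₂ a₃ b z110) (st ends o a₁ a₂ a₃ b z001) + T2 (st ends o a₁ a₂ a₃ b z000) (st ends o a₁ a₂ a₃ b z111) (st ends o a₁ a₂ a₃ b z001) + T2 (st ends o a₁ a₂ a₃ b z100) (st ends o a₁ a₂ a₃ b z011) (st ends o a₁ a₂ a₃ b z001) + T2 (st ends o a₁ a₂ a₃ b z101) (st ends o a₁ a₂ a₃ b z010) (st ends o a₁ a₂ a₃ b z001) + T2 (st ends o a₁ a₂ a₃ b z000) (st ends o a₁ a₂ a₃ b z101) (st ends o a₁ a₂ a₃ b z011) : ℤ) : R) := by exact_mod_cast i1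
  have l2_0 := lk1_eq _ _ v13 v2
  have l2_1 := lk2_eq' _ _ _ v1 v2 v23
  have l2_2 := lk2_eq' _ _ _ v0 v123 v2
  have l2_3 := lk2_eq' _ _ _ v12 v2 v3
  have l2_4 := lk2_eq' _ _ _ v0 v12 v23
  have i2 : (0 : ℤ) ≤ T1 (st ends o a₁ a₂ a₃ b z101) (st ends o a₁ a₂ a₃ b z010) + T2 (st ends o a₁ a₂ a₃ b z100) (st ends o a₁ a₂ a₃ b z010) (st ends o a₁ a₂ a₃ b z011) + T2 (st ends o a₁ a₂ a₃ b z000) (st ends o a₁ a₂ a₃ b z111) (st ends o a₁ a₂ a₃ b z010) + T2 (st ends o a₁ a₂ a₃ b z110) (st ends o a₁ a₂ a₃ b z010) (st ends o a₁ a₂ a₃ b z001) + T2 (st ends o a₁ a₂ a₃ b z000) (st ends o a₁ a₂ a₃ b z110) (st ends o a₁ a₂ a₃ b z011) := by omega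
  have c2 : (0 : R) ≤ ((T1 (st ends o a₁ a₂ a₃ b z101) (st ends o a₁ a₂ a₃ b z010) + T2 (st ends o a₁ a₂ a₃ b z100) (st ends o a₁ a₂ a₃ b z010) (st ends o a₁ a₂ a₃ b z011) + T2 (st ends o a₁ a₂ a₃ b z000) (st ends o a₁ a₂ a₃ b z111) (st ends o a₁ a₂ a₃ b z010) + T2 (st ends o a₁ a₂ a₃ b z110) (st ends o a₁ a₂ a₃ b z010) (st ends o a₁ a₂ a₃ b z001) + T2 (st ends o a₁ a₂ a₃ b z000) (st ends o a₁ a₂ a₃ b z110) (st ends o a₁ a₂ a₃ b z011) : ℤ) : R) := by exact_mod_cast i2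
  have l3_0 := lk1_eq _ _ v1 v23
  have l3_1 := lk2_eq' _ _ _ v13 v2 v23
  have l3_2 := lk2_eq' _ _ _ v12 v23 v3
  have l3_3 := lk2_eq' _ _ _ v0 v123 v23
  have l3_4 := lk2_eq' _ _ _ v123 v2 v3
  have i3 : (0 : ℤ) ≤ T1 (st ends o a₁ a₂ a₃ b z100) (st ends o a₁ a₂ a₃ b z011) + T2 (st ends o a₁ a₂ a₃ b z101) (st ends o a₁ a₂ a₃ b z010) (st ends o a₁ a₂ a₃ b z011) + T2 (st ends o a₁ a₂ a₃ b z110) (st ends o a₁ a₂ a₃ b z011) (st ends o a₁ a₂ a₃ b z001) + T2 (st ends o a₁ a₂ a₃ b z000) (st ends o a₁ a₂ a₃ b z111) (st ends o a₁ a₂ a₃ b z011) + T2 (st ends o a₁ a₂ a₃ b z111) (st ends o a₁ a₂ a₃ b z010) (st ends o a₁ a₂ a₃ b z001) := by omega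
  have c3 : (0 : R) ≤ ((T1 (st ends o a₁ a₂ a₃ b z100) (st ends o a₁ a₂ a₃ b z011) + T2 (st ends o a₁ a₂ a₃ b z101) (st ends o a₁ a₂ a₃ b z010) (st ends o a₁ a₂ a₃ b z011) + T2 (st ends o a₁ a₂ a₃ b z110) (st ends o a₁ a₂ a₃ b z011) (st ends o a₁ a₂ a₃ b z001) + T2 (st ends o a₁ a₂ a₃ b z000) (st ends o a₁ a₂ a₃ b z111) (st ends o a₁ a₂ a₃ b z011) + T2 (st ends o a₁ a₂ a₃ b z111) (st ends o a₁ a₂ a₃ b z010) (st ends o a₁ a₂ a₃ b z001) : ℤ) : R) := by exact_mod_cast i3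
  have l4_0 := lk1_eq _ _ v23 v1
  have l4_1 := lk2_eq' _ _ _ v1 v13 v2
  have l4_2 := lk2_eq' _ _ _ v1 v12 v3
  have l4_3 := lk2_eq' _ _ _ v0 v1 v123
  have l4_4 := lk2_eq' _ _ _ v0 v12 v13
  have i4 : (0 : ℤ) ≤ T1 (st ends o a₁ a₂ a₃ b z011) (st ends o a₁ a₂ a₃ b z100) + T2 (st ends o a₁ a₂ a₃ b z100) (st ends o a₁ a₂ a₃ b z101) (st ends o a₁ a₂ a₃ b z010) + T2 (st ends o a₁ a₂ a₃ b z100) (st ends o a₁ a₂ a₃ b z110) (st ends o a₁ a₂ a₃ b z001) + T2 (st ends o a₁ a₂ a₃ b z000) (st ends o a₁ a₂ a₃ b z100) (st ends o a₁ a₂ a₃ b z111) + T2 (st ends o a₁ a₂ a₃ b z000) (st ends o a₁ a₂ a₃ b z110) (st ends o a₁ a₂ a₃ b z101) := by omega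
  have c4 : (0 : R) ≤ ((T1 (st ends o a₁ a₂ a₃ b z011) (st ends o a₁ a₂ a₃ b z100) + T2 (st ends o a₁ a₂ a₃ b z100) (st ends o a₁ a₂ a₃ b z101) (st ends o a₁ a₂ a₃ b z010) + T2 (st ends o a₁ a₂ a₃ b z100) (st ends o a₁ a₂ a₃ b z110) (st ends o a₁ a₂ a₃ b z001) + T2 (st ends o a₁ a₂ a₃ b z000) (st ends o a₁ a₂ a₃ b z100) (st ends o a₁ a₂ a₃ b z111) + T2 (st ends o a₁ a₂ a₃ b z000) (st ends o a₁ a₂ a₃ b z110) (st ends o a₁ a₂ a₃ b z101) : ℤ) : R) := by exact_mod_cast i4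
  have l5_0 := lk1_eq _ _ v2 v13
  have l5_1 := lk2_eq' _ _ _ v1 v13 v23
  have l5_2 := lk2_eq' _ _ _ v0 v123 v13
  have l5_3 := lk2_eq' _ _ _ v12 v13 v3
  have l5_4 := lk2_eq' _ _ _ v1 v123 v3
  have i5 : (0 : ℤ) ≤ T1 (st ends o a₁ a₂ a₃ b z010) (st ends o a₁ a₂ a₃ b z101) + T2 (st ends o a₁ a₂ a₃ b z100) (st ends o a₁ a₂ a₃ b z101) (st ends o a₁ a₂ a₃ b z011) + T2 (st ends o a₁ a₂ a₃ b z000) (st ends o a₁ a₂ a₃ b z111) (st ends o a₁ a₂ a₃ b z101) + T2 (st ends o a₁ a₂ a₃ b z110) (st ends o a₁ a₂ a₃ b z101) (st ends o a₁ a₂ a₃ b z001) + T2 (st ends o a₁ a₂ a₃ b z100) (st ends o a₁ a₂ a₃ b z111) (st ends o a₁ a₂ a₃ b z001) := by omega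
  have c5 : (0 : R) ≤ ((T1 (st ends o a₁ a₂ a₃ b z010) (st ends o a₁ a₂ a₃ b z101) + T2 (st ends o a₁ a₂ a₃ b z100) (st ends o a₁ a₂ a₃ b z101) (st ends o a₁ a₂ a₃ b z011) + T2 (st ends o a₁ a₂ a₃ b z000) (st ends o a₁ a₂ a₃ b z111) (st ends o a₁ a₂ a₃ b z101) + T2 (st ends o a₁ a₂ a₃ b z110) (st ends o a₁ a₂ a₃ b z101) (st ends o a₁ a₂ a₃ b z001) + T2 (st ends o a₁ a₂ a₃ b z100) (st ends o a₁ a₂ a₃ b z111) (st ends o a₁ a₂ a₃ b z001) : ℤ) : R) := by exact_mod_cast i5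
  have l6_0 := lk1_eq _ _ v3 v12
  have l6_1 := lk2_eq' _ _ _ v0 v12 v123
  have l6_2 := lk2_eq' _ _ _ v1 v12 v23
  have l6_3 := lk2_eq' _ _ _ v12 v13 v2
  have l6_4 := lk2_eq' _ _ _ v1 v123 v2
  have i6 : (0 : ℤ) ≤ T1 (st ends o a₁ a₂ a₃ b z001) (st ends o a₁ a₂ a₃ b z110) + T2 (st ends o a₁ a₂ a₃ b z000) (st ends o a₁ a₂ a₃ b z110) (st ends o a₁ a₂ a₃ b z111) + T2 (st ends o a₁ a₂ a₃ b z100) (st ends o a₁ a₂ a₃ b z110) (st ends o a₁ a₂ a₃ b z011) + T2 (st ends o a₁ a₂ a₃ b z110) (st ends o a₁ a₂ a₃ b z101) (st ends o a₁ a₂ a₃ b z010) + T2 (st ends o a₁ a₂ a₃ b z100) (st ends o a₁ a₂ a₃ b z111) (st ends o a₁ a₂ a₃ b z010) := by omega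
  have c6 : (0 : R) ≤ ((T1 (st ends o a₁ a₂ a₃ b z001) (st ends o a₁ a₂ a₃ b z110) + T2 (st ends o a₁ a₂ a₃ b z000) (st ends o a₁ a₂ a₃ b z110) (st ends o a₁ a₂ a₃ b z111) + T2 (st ends o a₁ a₂ a₃ b z100) (st ends o a₁ a₂ a₃ b z110) (st ends o a₁ a₂ a₃ b z011) + T2 (st ends o a₁ a₂ a₃ b z110) (st ends o a₁ a₂ a₃ b z101) (st ends o a₁ a₂ a₃ b z010) + T2 (st ends o a₁ a₂ a₃ b z100) (st ends o a₁ a₂ a₃ b z111) (st ends o a₁ a₂ a₃ b z010) : ℤ) : R) := by exact_mod_cast i6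
  have l7_0 := lk1_eq _ _ v0 v123
  have l7_1 := lk2_eq' _ _ _ v12 v123 v3
  have l7_2 := lk2_eq' _ _ _ v123 v13 v2
  have l7_3 := lk2_eq' _ _ _ v1 v123 v23
  have l7_4 := lk2_eq' _ _ _ v12 v13 v23
  have i7 : (0 : ℤ) ≤ T1 (st ends o a₁ a₂ a₃ b z000) (st ends o a₁ a₂ a₃ b z111) + T2 (st ends o a₁ a₂ a₃ b z110) (st ends o a₁ a₂ a₃ b z111) (st ends o a₁ a₂ a₃ b z001) + T2 (st ends o a₁ a₂ a₃ b z111) (st ends o a₁ a₂ a₃ b z101) (st ends o a₁ a₂ a₃ b z010) + T2 (st ends o a₁ a₂ a₃ b z100) (st ends o a₁ a₂ a₃ b z111) (st ends o a₁ a₂ a₃ b z011) + T2 (st ends o a₁ a₂ a₃ b z110) (st ends o a₁ a₂ a₃ b z101) (st ends o a₁ a₂ a₃ b z011) := by omega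
  have c7 : (0 : R) ≤ ((T1 (st ends o a₁ a₂ a₃ b z000) (st ends o a₁ a₂ a₃ b z111) + T2 (st ends o a₁ a₂ a₃ b z110) (st ends o a₁ a₂ a₃ b z111) (st ends o a₁ a₂ a₃ b z001) + T2 (st ends o a₁ a₂ a₃ b z111) (st ends o a₁ a₂ a₃ b z101) (st ends o a₁ a₂ a₃ b z010) + T2 (st ends o a₁ a₂ a₃ b z100) (st ends o a₁ a₂ a₃ b z111) (st ends o a₁ a₂ a₃ b z011) + T2 (st ends o a₁ a₂ a₃ b z110) (st ends o a₁ a₂ a₃ b z101) (st ends o a₁ a₂ a₃ b z011) : ℤ) : R) := by exact_mod_cast i7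
  simp only [T1, T2] at c0 c1 c2 c3 c4 c5 c6 c7
  push_cast at c0 c1 c2 c3 c4 c5 c6 c7
  rcases h₁ with h | h <;> rcases h₂ with h' | h' <;> rcases h₃ with h'' | h'' <;>
    simp only [h, h', h''] <;> norm_num <;> simp only [K3_eq_KB ends o a₁ a₂ a₃ b] <;> linarith

/-- **`TypedBases` for at most three typed edges**, modulo `allOk3 = true`. -/
theorem typedCount_nonneg_of_card_le_three (hall : allOk3 = true) (F : Finset E) (hF : F.card ≤ 3)
    (z : Config E) (τ : E → ℕ) (hτ : ∀ e ∈ F, τ e = 1 ∨ τ e = 2) :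
    0 ≤ typedCount F z τ (K3 ends o a₁ a₂ a₃ b : Config E → Config E → Config E → R) := by
  rcases Nat.lt_or_ge F.card 3 with h | h
  · exact typedCount_nonneg_of_card_le_two ends o a₁ a₂ a₃ b F (by omega) z τ hτ
  · obtain ⟨e₁, e₂, e₃, h12, h13, h23, rfl⟩ := Finset.card_eq_three.mp (show F.card = 3 by omega)
    exact typedCount_triple_K3_nonneg ends o a₁ a₂ a₃ b hall e₁ e₂ e₃ h12 h13 h23 z τ
      (hτ e₁ (by simp)) (hτ e₂ (by simp)) (hτ e₃ (by simp))

end Main3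

section Weighted3

variable {V : Type*} {E : Type*} [Fintype E] [DecidableEq E] {R : Type*} [Field R] [LinearOrder R]
  [IsStrictOrderedRing R] (ends : E → Sym2 V) (o a₁ a₂ a₃ b : V)

/-- **(HCOV) with at most three fractional edges**, modulo `allOk3 = true`. -/
theorem Gc_nonneg_of_fractional_le_three (hall : allOk3 = true) (p : E → R) (hp : IsProbVec p)
    (hfrac : (Finset.univ.filter fun e => p e ≠ 0 ∧ p e ≠ 1).card ≤ 3) :
    0 ≤ Gc p ends o a₁ a₂ a₃ b := by
  rw [hcov_cubic p ends o a₁ a₂ a₃ b (fun _ => 0)]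
  refine triSum_nonneg_of_typedCount_subset (K3 ends o a₁ a₂ a₃ b)
    (Finset.univ.filter fun e => p e ≠ 0 ∧ p e ≠ 1) ?_ p (fun e => ⟨hp.nonneg e, hp.le_one e⟩) ?_ ∅
    (Finset.empty_subset _) (fun _ => 0) (fun e he => absurd he (Finset.notMem_empty e))
  · intro G hG z σ hσ
    exact typedCount_nonneg_of_card_le_three ends o a₁ a₂ a₃ b hall G
      (le_trans (Finset.card_le_card hG) hfrac) z σ hσ
  · intro e he
    simp only [Finset.mem_filter, Finset.mem_univ, true_and, not_and, not_not] at he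
    by_cases h : p e = 0
    · exact Or.inl h
    · exact Or.inr (he h)

end Weighted3

end TwoTyped

end CovForm

end Summit.Ventures.PercRepro2
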